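import Summits.Schanuel.Schanuel.Theorems.ZilberEacExpExpBalanceLemmas
import HarnessLib

/-!
# The exponential–exponential balance over quadratic graph bases (existence, every sign)

Zilber's Exponential-Algebraic Closedness, case ladder (host summit Schanuel, cell `pub-schanuel`,
seat 2, gen 8).  For a QUADRATIC base polynomial `p(z) = α z² + β z + γ` (`α ≠ 0`), ANY `A ∈ ℂ[x]`
and any `F ∈ ℂ[u] ∖ {0}` the equation `e^{z} = A(z) + e^{p(z)} F(e^{p(z)})` — exponential points of
`{x₁ = p(x₀), y₀ = A(x₀) + y₁ F(y₁)}` — has infinitely many solutions, with `Re p(z) → +∞`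
(`exists_solution_expExp_quadratic`).  No sign condition: this covers the EXPLOSION regime
`Re(lc(p) i²) > 0` (e.g. `x₁ = -x₀²`, where `Re p → +∞` along every lattice ray and none of the
lattice-centre theorems applies) left open by `ZilberEacMovingGraph{,Oscillatory}`.

Mechanism (seat 2 gen 3's "diagonal escape" `e^{z} = z + e^{-2z²}`, made general): balance the two
exponentials, `e^{z} ≈ lc(F) e^{e p(z)}` (`e = 1 + deg F`).  With `ζ := z - e p(z) - log lc(F) - 2πiqk`
the equation reads `e^{ζ} = 1 + g`, `g = (A(z) + u F̃(u)) e^{ζ - z}` (`u = e^{p(z)}`, `F̃ = eraseLead F`),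
and along the branch `z(ζ) = (μ √k (1 + η(ζ))^{1/2} - (eβ - 1))/(2eα)`, `μ² = -8π e α q i`,
`η = O(1/k)` affine in `ζ`, of the quadratic relation one has `Re z ≥ ρ √k - O(1)` with
`ρ = Re(μ/(2eα)) > 0` (`exists_sign_sqrt`), so `g → 0` uniformly on `‖ζ‖ < 1`
(`|A(z)| e^{-Re z}`: polynomial against exponential; `|u F̃(u)| e^{-Re z}`: Young split with
`|u|^{e} |lc F| = e^{Re z - Re ζ}`), and the one-variable contraction lemma
`ExpDominant.exists_exp_eq_one_add` applies.

HONEST FRAMING: existence for these `n = 2` surfaces is Mantova–Masser's Theorem 1.1 in print; NEW is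
the explicit mechanism with `Re p(z) ≍ √k`, which feeds THEOREM G (density: `ZilberEacExpExpDensity`);
`EC(3,2)` OPEN; NOT Schanuel's conjecture; EAC ⇏ SC.
-/

noncomputable section

open Complex Filter Topology Metric
open Literature.NumberTheory.Transcendental

set_option linter.dupNamespace false

namespace Summit.Schanuel.Schanuel.Theorems

set_option maxHeartbeats 400000 in
/-- **Exponential–exponential balance over a quadratic base.**  For `α ≠ 0`, `β, γ ∈ ℂ`, any
`A ∈ ℂ[x]` and `F ≠ 0` there are `ρ > 0` and `C` such that for all large `k` the equation
`e^{z} = A(z) + e^{p(z)} F(e^{p(z)})`, `p(z) = αz² + βz + γ`, has a solution with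
`ρ √k ≤ Re p(z)` and `‖p(z)‖ ≤ C k`. (new) [cite: MantovaMasser2023, §1 Further remarks] -/
theorem exists_solution_expExp_quadratic {α : ℂ} (hα : α ≠ 0) (β γ : ℂ) (A : Polynomial ℂ)
    {F : Polynomial ℂ} (hF : F ≠ 0) :
    ∃ ρ C : ℝ, 0 < ρ ∧ ∀ᶠ k : ℕ in atTop, ∃ z : ℂ,
      exp z = A.eval z + exp (α * z ^ 2 + β * z + γ) * F.eval (exp (α * z ^ 2 + β * z + γ)) ∧
      ρ * Real.sqrt k ≤ (α * z ^ 2 + β * z + γ).re ∧ ‖α * z ^ 2 + β * z + γ‖ ≤ C * k := by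
  classical
  -- ### names
  set e : ℕ := F.natDegree + 1 with he
  have hepos : 0 < e := by positivity
  have he0 : (e : ℂ) ≠ 0 := by exact_mod_cast hepos.ne'
  have he1 : (1 : ℝ) ≤ e := by exact_mod_cast hepos
  set c : ℂ := F.leadingCoeff with hcdef
  have hc0 : c ≠ 0 := Polynomial.leadingCoeff_ne_zero.2 hF
  have hcpos : 0 < ‖c‖ := norm_pos_iff.2 hc0
  set Λ : ℂ := Complex.log c with hΛ
  have hexpΛ : exp Λ = c := Complex.exp_log hc0
  set Fe : Polynomial ℂ := F.eraseLead with hFe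
  set pf : ℂ → ℂ := fun z => α * z ^ 2 + β * z + γ with hpf
  obtain ⟨q, μ, hq, hμ2, hρ⟩ := exists_sign_sqrt hα hepos
  set ρ : ℝ := (μ / (2 * e * α)).re with hρdef
  set M : ℂ := -(8 * Real.pi * e * α * q * I) with hM
  have hq0 : (q : ℂ) ≠ 0 := by rcases hq with rfl | rfl <;> simp
  have hM0 : M ≠ 0 := by
    rw [hM, neg_ne_zero]
    have hpi : (Real.pi : ℂ) ≠ 0 := Complex.ofReal_ne_zero.2 Real.pi_ne_zero
    exact mul_ne_zero (mul_ne_zero (mul_ne_zero (mul_ne_zero (mul_ne_zero (by norm_num) hpi) he0) hα)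
      hq0) Complex.I_ne_zero
  have hMpos : 0 < ‖M‖ := norm_pos_iff.2 hM0
  have h2eα : (2 * (e : ℂ) * α) ≠ 0 := mul_ne_zero (mul_ne_zero two_ne_zero he0) hα
  have h2eαpos : 0 < ‖2 * (e : ℂ) * α‖ := norm_pos_iff.2 h2eα
  set E₀ : ℂ := (e * β - 1) ^ 2 - 4 * e * α * (e * γ + Λ) with hE₀
  -- the branch
  set η : ℕ → ℂ → ℂ := fun k ζ => (E₀ - 4 * e * α * ζ) / (M * k) with hη
  set yf : ℕ → ℂ → ℂ := fun k ζ => μ * (Real.sqrt k : ℂ) * (1 + η k ζ) ^ ((2 : ℂ)⁻¹) with hyf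
  set zf : ℕ → ℂ → ℂ := fun k ζ => (yf k ζ - (e * β - 1)) / (2 * e * α) with hzf
  -- constants
  set Cη : ℝ := (‖E₀‖ + 4 * e * ‖α‖) / ‖M‖ with hCη
  have hCη0 : 0 ≤ Cη := by positivity
  set Cz : ℝ := (‖μ‖ * Cη + ‖(e : ℂ) * β - 1‖) / ‖2 * (e : ℂ) * α‖ with hCz
  have hCz0 : 0 ≤ Cz := by positivity
  set Cz' : ℝ := ‖μ‖ / ‖2 * (e : ℂ) * α‖ + Cz + 1 with hCz'
  have hCz'1 : 1 ≤ Cz' := by rw [hCz']; linarith [div_nonneg (norm_nonneg μ) h2eαpos.le]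
  -- ### Step 1: estimates on the branch for `‖ζ‖ < 1`, `k` large
  have hbranch : ∀ᶠ k : ℕ in atTop, ∀ ζ : ℂ, ‖ζ‖ < 1 →
      ‖η k ζ‖ ≤ 1 / 2 ∧ ρ * Real.sqrt k - Cz ≤ (zf k ζ).re ∧ ‖zf k ζ‖ ≤ Cz' * Real.sqrt k ∧
      (2 * e * α * zf k ζ + (e * β - 1)) ^ 2 = M * k + E₀ - 4 * e * α * ζ := by
    have hk1 : ∀ᶠ k : ℕ in atTop, 2 * Cη ≤ (k : ℝ) := tendsto_natCast_atTop_atTop.eventually_ge_atTop _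
    filter_upwards [hk1, eventually_ge_atTop 1] with k hk hk_one ζ hζ
    have hk0 : (0 : ℝ) < k := by exact_mod_cast hk_one
    have hsk1 : 1 ≤ Real.sqrt k := by
      rw [show (1 : ℝ) = Real.sqrt 1 by simp]; exact Real.sqrt_le_sqrt (by exact_mod_cast hk_one)
    have hsk0 : 0 < Real.sqrt k := by linarith
    -- `‖η‖ ≤ Cη / k ≤ 1/2`
    have hnum : ‖E₀ - 4 * e * α * ζ‖ ≤ ‖E₀‖ + 4 * e * ‖α‖ := by
      refine (norm_sub_le _ _).trans (add_le_add le_rfl ?_)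
      rw [norm_mul, norm_mul, norm_mul, Complex.norm_natCast]
      have h4 : ‖(4 : ℂ)‖ = 4 := by simp
      rw [h4]
      calc 4 * (e : ℝ) * ‖α‖ * ‖ζ‖ ≤ 4 * e * ‖α‖ * 1 := by gcongr
        _ = 4 * e * ‖α‖ := mul_one _
    have hηb : ‖η k ζ‖ ≤ Cη / k := by
      have h1 : ‖η k ζ‖ ≤ (‖E₀‖ + 4 * e * ‖α‖) / (‖M‖ * k) := by
        simp only [hη]
        rw [norm_div, norm_mul, Complex.norm_natCast]
        exact div_le_div_of_nonneg_right hnum (by positivity)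
      rw [hCη, div_div]
      exact h1
    have hηhalf : ‖η k ζ‖ ≤ 1 / 2 := by
      refine hηb.trans ?_
      rw [div_le_iff₀ hk0]; linarith
    obtain ⟨-, hwsq, -, hw1⟩ := sqrt_one_add_facts hηhalf
    set w : ℂ := (1 + η k ζ) ^ ((2 : ℂ)⁻¹) with hw
    -- the algebraic relation
    have hrel : (2 * e * α * zf k ζ + (e * β - 1)) ^ 2 = M * k + E₀ - 4 * e * α * ζ := by
      have h1 : 2 * e * α * zf k ζ + (e * β - 1) = yf k ζ := by
        simp only [hzf]; field_simp; ring
      rw [h1]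
      simp only [hyf]
      rw [mul_pow, mul_pow, hwsq, hμ2, ← Complex.ofReal_pow, Real.sq_sqrt hk0.le,
        Complex.ofReal_natCast]
      simp only [hη]
      have hkC : (k : ℂ) ≠ 0 := by exact_mod_cast hk0.ne'
      field_simp
      ring
    -- the branch estimates: `z = (μ/(2eα)) √k + r`, `‖r‖ ≤ Cz`
    set r : ℂ := (μ * (Real.sqrt k : ℂ) * (w - 1) - (e * β - 1)) / (2 * e * α) with hr
    have hzsplit : zf k ζ = μ / (2 * e * α) * (Real.sqrt k : ℂ) + r := by
      simp only [hzf, hyf, hr, hw]; field_simp; ring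
    have hrb : ‖r‖ ≤ Cz := by
      rw [hr, norm_div, hCz]
      refine div_le_div_of_nonneg_right ((norm_sub_le _ _).trans (add_le_add ?_ le_rfl)) h2eαpos.le
      rw [norm_mul, norm_mul, Complex.norm_real, Real.norm_of_nonneg hsk0.le]
      calc ‖μ‖ * Real.sqrt k * ‖w - 1‖ ≤ ‖μ‖ * Real.sqrt k * (Cη / k) :=
            mul_le_mul_of_nonneg_left (hw1.trans hηb) (by positivity)
        _ = ‖μ‖ * Cη * (Real.sqrt k / k) := by ring
        _ ≤ ‖μ‖ * Cη * 1 := by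
            refine mul_le_mul_of_nonneg_left ?_ (by positivity)
            rw [div_le_one hk0]
            nlinarith [Real.sq_sqrt hk0.le, hsk1]
        _ = ‖μ‖ * Cη := mul_one _
    refine ⟨hηhalf, ?_, ?_, hrel⟩
    · rw [hzsplit, Complex.add_re]
      have h1 : (μ / (2 * e * α) * (Real.sqrt k : ℂ)).re = ρ * Real.sqrt k := by
        rw [mul_comm, Complex.re_ofReal_mul, hρdef, mul_comm]
      rw [h1]
      have h2 : |r.re| ≤ Cz := (Complex.abs_re_le_norm r).trans hrb
      rw [abs_le] at h2
      linarith
    · rw [hzsplit]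
      refine (norm_add_le _ _).trans ?_
      rw [norm_mul, Complex.norm_real, Real.norm_of_nonneg hsk0.le, norm_div, hCz']
      nlinarith [hrb, hsk1, div_nonneg (norm_nonneg μ) h2eαpos.le]
  -- ### Step 2: the bound constants and the choice of `T`
  set BA : ℝ := ∑ i ∈ Finset.range (A.natDegree + 1), ‖A.coeff i‖ with hBA
  have hBA0 : 0 ≤ BA := Finset.sum_nonneg fun _ _ => norm_nonneg _
  set Be : ℝ := ∑ i ∈ Finset.range (Fe.natDegree + 1), ‖Fe.coeff i‖ with hBe
  have hBe0 : 0 ≤ Be := Finset.sum_nonneg fun _ _ => norm_nonneg _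
  set T : ℝ := 96 * (Be + 1) * Real.exp 2 / ‖c‖ + 1 with hT
  have hTpos : 0 < T := by rw [hT]; positivity
  -- ### Step 3: the perturbation and its smallness
  set g : ℕ → ℂ → ℂ := fun k ζ =>
    (A.eval (zf k ζ) + exp (pf (zf k ζ)) * Fe.eval (exp (pf (zf k ζ)))) * exp (ζ - zf k ζ) with hg
  have hsmall : ∀ᶠ k : ℕ in atTop, ∀ ζ : ℂ, ‖ζ‖ < 1 → ‖g k ζ‖ ≤ 1 / 32 := by
    have hdecA := (tendsto_sqrt_pow_mul_exp_neg A.natDegree hρ (Cz + 1)).const_mul (BA * Cz' ^ A.natDegree)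
    have hdecF := (tendsto_sqrt_pow_mul_exp_neg 0 hρ (Cz + 1)).const_mul ((Be + 1) * (1 / T + T ^ F.natDegree))
    rw [mul_zero] at hdecA hdecF
    filter_upwards [hbranch, hdecA.eventually (eventually_le_nhds (by norm_num : (0:ℝ) < 1 / 96)),
      hdecF.eventually (eventually_le_nhds (by norm_num : (0:ℝ) < 1 / 96)), eventually_ge_atTop 1]
      with k hbr hkA hkF hk_one ζ hζ
    obtain ⟨-, hzre, hznorm, hrel⟩ := hbr ζ hζ
    have hk0 : (0 : ℝ) < k := by exact_mod_cast hk_one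
    have hsk1 : 1 ≤ Real.sqrt k := by
      rw [show (1 : ℝ) = Real.sqrt 1 by simp]; exact Real.sqrt_le_sqrt (by exact_mod_cast hk_one)
    -- the key identity `c u^e = exp (z - ζ)` from the quadratic relation, for `z = zf k ζ`
    have hzrel : zf k ζ - e * pf (zf k ζ) - Λ - ζ = 2 * Real.pi * I * (q * k : ℂ) := by
      have h4 : 4 * e * α ≠ (0 : ℂ) := mul_ne_zero (mul_ne_zero (by norm_num) he0) hα
      have h := hrel
      simp only [hpf]
      rw [hM, hE₀] at h
      have h' : 4 * e * α * (e * (α * zf k ζ ^ 2 + β * zf k ζ + γ) - zf k ζ + Λ + ζ +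
          2 * Real.pi * I * (q * k)) = 0 := by
        linear_combination h
      have h'' := (mul_eq_zero.1 h').resolve_left h4
      linear_combination -h''
    have hcue : c * exp (pf (zf k ζ)) ^ e = exp (zf k ζ - ζ) := by
      have h1 : zf k ζ - ζ = (Λ + e * pf (zf k ζ)) + ((q * k : ℤ) : ℂ) * (2 * Real.pi * I) := by
        push_cast; linear_combination hzrel
      rw [h1, Complex.exp_add (Λ + (e : ℂ) * pf (zf k ζ)), Complex.exp_int_mul_two_pi_mul_I, mul_one,
        Complex.exp_add Λ, hexpΛ, ← Complex.exp_nat_mul]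
    have hbound := expExp_perturbation_bound A hF hTpos (zf k ζ) ζ (exp (pf (zf k ζ))) hζ
      (by rw [← hcdef, ← he]; exact hcue)
    rw [← hFe, ← hcdef, ← hBA, ← hBe] at hbound
    -- the three small quantities
    have hexpz : Real.exp (1 - (zf k ζ).re) ≤ Real.exp (-(ρ * Real.sqrt k - (Cz + 1))) :=
      Real.exp_le_exp.2 (by linarith)
    have hmax : max 1 ‖zf k ζ‖ ≤ Cz' * Real.sqrt k := max_le (by nlinarith) hznorm
    have hmax0 : 0 ≤ max 1 ‖zf k ζ‖ := zero_le_one.trans (le_max_left _ _)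
    have hA' : BA * max 1 ‖zf k ζ‖ ^ A.natDegree * Real.exp (1 - (zf k ζ).re) ≤ 1 / 96 := by
      calc BA * max 1 ‖zf k ζ‖ ^ A.natDegree * Real.exp (1 - (zf k ζ).re)
          ≤ BA * (Cz' * Real.sqrt k) ^ A.natDegree * Real.exp (-(ρ * Real.sqrt k - (Cz + 1))) :=
            mul_le_mul (mul_le_mul_of_nonneg_left (pow_le_pow_left₀ hmax0 hmax _) hBA0) hexpz
              (Real.exp_pos _).le (by positivity)
        _ = BA * Cz' ^ A.natDegree * (Real.sqrt k ^ A.natDegree * Real.exp (-(ρ * Real.sqrt k - (Cz + 1)))) := by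
            rw [mul_pow]; ring
        _ ≤ 1 / 96 := hkA
    have hF' : (Be + 1) * (1 / T + T ^ F.natDegree) * Real.exp (1 - (zf k ζ).re) ≤ 1 / 96 := by
      calc (Be + 1) * (1 / T + T ^ F.natDegree) * Real.exp (1 - (zf k ζ).re)
          ≤ (Be + 1) * (1 / T + T ^ F.natDegree) * Real.exp (-(ρ * Real.sqrt k - (Cz + 1))) :=
            mul_le_mul_of_nonneg_left hexpz (by positivity)
        _ = (Be + 1) * (1 / T + T ^ F.natDegree) * (Real.sqrt k ^ 0 * Real.exp (-(ρ * Real.sqrt k - (Cz + 1)))) := by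
            rw [pow_zero, one_mul]
        _ ≤ 1 / 96 := hkF
    have hT' : (Be + 1) * Real.exp 2 / (‖c‖ * T) ≤ 1 / 96 := by
      rw [div_le_iff₀ (by positivity), hT]
      have : ‖c‖ * (96 * (Be + 1) * Real.exp 2 / ‖c‖ + 1) = 96 * (Be + 1) * Real.exp 2 + ‖c‖ := by
        field_simp
      rw [this]
      linarith [hcpos.le]
    have hgk : g k ζ = (A.eval (zf k ζ) + exp (pf (zf k ζ)) * Fe.eval (exp (pf (zf k ζ)))) *
        exp (ζ - zf k ζ) := rfl
    rw [hgk]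
    have hb2 : (BA * max 1 ‖zf k ζ‖ ^ A.natDegree + (Be + 1) * (1 / T + T ^ F.natDegree)) *
          Real.exp (1 - (zf k ζ).re) + (Be + 1) * Real.exp 2 / (‖c‖ * T) ≤ 1 / 32 := by
      rw [add_mul]
      calc BA * max 1 ‖zf k ζ‖ ^ A.natDegree * Real.exp (1 - (zf k ζ).re) +
            (Be + 1) * (1 / T + T ^ F.natDegree) * Real.exp (1 - (zf k ζ).re) +
            (Be + 1) * Real.exp 2 / (‖c‖ * T) ≤ 1 / 96 + 1 / 96 + 1 / 96 :=
            add_le_add (add_le_add hA' hF') hT'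
        _ = 1 / 32 := by norm_num
    exact le_trans hbound hb2

  -- ### Step 4: holomorphy of the perturbation on the unit disc
  have hdiff : ∀ᶠ k : ℕ in atTop, DifferentiableOn ℂ (g k) (ball 0 1) := by
    filter_upwards [hbranch, eventually_ge_atTop 1] with k hbr hk_one
    have hηdiff : Differentiable ℂ (η k) := by
      simp only [hη]
      exact ((differentiable_const _).sub ((differentiable_const _).mul differentiable_id)).div_const _
    have hwdiff : DifferentiableOn ℂ (fun ζ => (1 + η k ζ) ^ ((2 : ℂ)⁻¹)) (ball 0 1) := by
      intro ζ hζ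
      rw [mem_ball, dist_zero_right] at hζ
      refine (((differentiable_const _).add hηdiff).differentiableAt.cpow_const ?_).differentiableWithinAt
      exact (sqrt_one_add_facts (hbr ζ hζ).1).1
    have hzdiff : DifferentiableOn ℂ (zf k) (ball 0 1) := by
      simp only [hzf, hyf]
      exact (((differentiableOn_const _).mul hwdiff).sub (differentiableOn_const _)).div_const _
    have hpdiff : Differentiable ℂ pf := by
      simp only [hpf]; fun_prop
    have hudiff : DifferentiableOn ℂ (fun ζ => exp (pf (zf k ζ))) (ball 0 1) :=
      (hpdiff.comp_differentiableOn hzdiff).cexp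
    simp only [hg]
    refine DifferentiableOn.mul (DifferentiableOn.add ?_ ?_) ?_
    · exact A.differentiable.comp_differentiableOn hzdiff
    · exact hudiff.mul (Fe.differentiable.comp_differentiableOn hudiff)
    · exact (differentiableOn_id.sub hzdiff).cexp
  -- ### Step 5: conclusion
  refine ⟨ρ / (2 * e), (‖α‖ * Cz' ^ 2 + ‖β‖ * Cz' + ‖γ‖), by positivity, ?_⟩
  have hkbig : ∀ᶠ k : ℕ in atTop, Cz + 1 + ‖Λ‖ ≤ ρ / 2 * Real.sqrt k :=
    ((Real.tendsto_sqrt_atTop.comp tendsto_natCast_atTop_atTop).const_mul_atTop (half_pos hρ)).eventually_ge_atTop _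
  filter_upwards [hbranch, hsmall, hdiff, hkbig, eventually_ge_atTop 1] with k hbr hsm hdf hkb hk_one
  have hk0 : (0 : ℝ) < k := by exact_mod_cast hk_one
  have hsk1 : 1 ≤ Real.sqrt k := by
    rw [show (1 : ℝ) = Real.sqrt 1 by simp]; exact Real.sqrt_le_sqrt (by exact_mod_cast hk_one)
  -- the contraction lemma in one variable
  set G : Fin 1 → (Fin 1 → ℂ) → ℂ := fun _ ξ => g k (ξ 0) with hG
  have hproj : Set.MapsTo (fun ξ : Fin 1 → ℂ => ξ 0) (ball 0 1) (ball 0 1) := by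
    intro ξ hξ
    rw [mem_ball, dist_zero_right] at hξ ⊢
    exact lt_of_le_of_lt (norm_le_pi_norm ξ 0) hξ
  have hGdiff : ∀ j, DifferentiableOn ℂ (G j) (ball 0 1) := fun _ =>
    hdf.comp (differentiable_apply (0 : Fin 1)).differentiableOn hproj
  have hGbound : ∀ j, ∀ ξ ∈ ball (0 : Fin 1 → ℂ) 1, ‖G j ξ‖ ≤ 1 / 32 := by
    intro j ξ hξ
    rw [mem_ball, dist_zero_right] at hξ
    exact hsm (ξ 0) (lt_of_le_of_lt (norm_le_pi_norm ξ 0) hξ)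
  obtain ⟨ξ, hξ, hfix⟩ := ExpDominant.exists_exp_eq_one_add G (ε := 1 / 32) (by norm_num) (by norm_num)
    hGdiff hGbound
  set ζ : ℂ := ξ 0 with hζdef
  have hζ1 : ‖ζ‖ < 1 := lt_of_le_of_lt ((norm_le_pi_norm ξ 0).trans hξ) (by norm_num)
  obtain ⟨-, hzre, hznorm, hrel⟩ := hbr ζ hζ1
  set z : ℂ := zf k ζ with hz
  set u : ℂ := exp (pf z) with hu
  have hzrel : z - e * pf z - Λ - ζ = 2 * Real.pi * I * (q * k : ℂ) := by
    have h4 : 4 * e * α ≠ (0 : ℂ) := mul_ne_zero (mul_ne_zero (by norm_num) he0) hα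
    have h := hrel
    simp only [hpf]
    rw [hM, hE₀] at h
    have h' : 4 * e * α * (e * (α * z ^ 2 + β * z + γ) - z + Λ + ζ + 2 * Real.pi * I * (q * k)) = 0 := by
      linear_combination h
    have h'' := (mul_eq_zero.1 h').resolve_left h4
    linear_combination -h''
  have hcue : c * u ^ e = exp (z - ζ) := by
    have h1 : z - ζ = (Λ + e * pf z) + ((q * k : ℤ) : ℂ) * (2 * Real.pi * I) := by
      push_cast; linear_combination hzrel
    rw [h1, Complex.exp_add (Λ + (e : ℂ) * pf z), Complex.exp_int_mul_two_pi_mul_I, mul_one,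
      Complex.exp_add Λ, hexpΛ, hu, ← Complex.exp_nat_mul]
  refine ⟨z, ?_, ?_, ?_⟩
  · -- the equation
    have hmain : exp ζ = 1 + g k ζ := hfix 0
    have hgz : g k ζ = (A.eval z + u * Fe.eval u) * exp (ζ - z) := rfl
    have h1 : exp z = exp (z - ζ) + (A.eval z + u * Fe.eval u) := by
      have h2 : exp z = exp (z - ζ) * exp ζ := by
        rw [← Complex.exp_add]; congr 1; ring
      rw [h2, hmain, hgz, mul_add, mul_one, ← mul_assoc, mul_comm (exp (z - ζ)) (A.eval z + _),
        mul_assoc, ← Complex.exp_add, show z - ζ + (ζ - z) = 0 by ring, Complex.exp_zero, mul_one]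
    have hsplit := mul_eval_eq_leadingCoeff_mul_pow_add F u
    rw [← he, ← hcdef, ← hFe] at hsplit
    show exp z = A.eval z + u * F.eval u
    rw [hsplit, h1, ← hcue]
    ring
  · -- `Re p(z) = (Re z - Re ζ - Re Λ)/e ≥ (ρ/(2e)) √k`
    have hpre : (pf z).re = (z.re - ζ.re - Λ.re) / e := by
      have : (e : ℂ) * pf z = z - Λ - ζ - 2 * Real.pi * I * (q * k : ℂ) := by linear_combination -hzrel
      have h := congrArg Complex.re this
      rw [show ((e : ℂ) * pf z).re = e * (pf z).re by
        rw [show (e : ℂ) = ((e : ℝ) : ℂ) by push_cast; rfl, Complex.re_ofReal_mul]] at h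
      simp only [Complex.sub_re] at h
      have him : (2 * Real.pi * I * (q * k : ℂ)).re = 0 := by
        simp [Complex.mul_re, Complex.mul_im]
      rw [him, sub_zero] at h
      field_simp
      linarith
    have hζre : ζ.re ≤ 1 := (abs_le.1 ((Complex.abs_re_le_norm ζ).trans hζ1.le)).2
    have hΛre : Λ.re ≤ ‖Λ‖ := Complex.re_le_norm Λ
    show ρ / (2 * e) * Real.sqrt k ≤ (α * z ^ 2 + β * z + γ).re
    rw [show (α * z ^ 2 + β * z + γ) = pf z from rfl, hpre, le_div_iff₀ (by positivity)]
    have : ρ / (2 * e) * Real.sqrt k * e = ρ / 2 * Real.sqrt k := by field_simp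
    rw [this]
    linarith
  · -- `‖p(z)‖ ≤ C k`
    show ‖α * z ^ 2 + β * z + γ‖ ≤ (‖α‖ * Cz' ^ 2 + ‖β‖ * Cz' + ‖γ‖) * k
    have hk1' : (1 : ℝ) ≤ k := by exact_mod_cast hk_one
    have hzk : ‖z‖ ≤ Cz' * Real.sqrt k := hznorm
    have hz2 : ‖z‖ ^ 2 ≤ Cz' ^ 2 * k := by
      calc ‖z‖ ^ 2 ≤ (Cz' * Real.sqrt k) ^ 2 := pow_le_pow_left₀ (norm_nonneg _) hzk 2
        _ = Cz' ^ 2 * k := by rw [mul_pow, Real.sq_sqrt hk0.le]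
    have hsqk : Real.sqrt k ≤ k := by nlinarith [Real.sq_sqrt hk0.le, hsk1]
    calc ‖α * z ^ 2 + β * z + γ‖ ≤ ‖α‖ * ‖z‖ ^ 2 + ‖β‖ * ‖z‖ + ‖γ‖ := by
          refine (norm_add_le _ _).trans (add_le_add ((norm_add_le _ _).trans (add_le_add ?_ ?_)) le_rfl)
          · rw [norm_mul, norm_pow]
          · rw [norm_mul]
      _ ≤ ‖α‖ * (Cz' ^ 2 * k) + ‖β‖ * (Cz' * k) + ‖γ‖ * k := by
          gcongr
          · exact hzk.trans (by nlinarith)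
          · nlinarith [norm_nonneg γ]
      _ = (‖α‖ * Cz' ^ 2 + ‖β‖ * Cz' + ‖γ‖) * k := by ring

end Summit.Schanuel.Schanuel.Theorems

end
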